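import Literature.IUT.HodgeTheaters.KitCoreBridge
import HarnessLib

/-!
# [IUTchI] Definition 6.1 (iii): the natural bijection `{LabCusp^±(†𝒟_v) ∖ {†η⁰_v}}/{±1} ⥲ LabCusp(†𝒟_v)`,
# `†η^±_v ↦ †η_v`, compatible with Proposition 4.2 — typed through the §4 ↔ §6 dictionary `KitCore(K, 𝔡)`

S. Mochizuki, *Inter-universal Teichmüller theory I*, kurims manuscript (May 2020), §6 Definition 6.1 (iii)
p. 156 l.–p. 157: "`LabCusp^±(†𝒟_v)` admits a natural action by `𝔽_l^×` …, as well as a zero element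
`†η⁰_v ∈ LabCusp^±(†𝒟_v)` and a `±`-canonical element `†η^±_v ∈ LabCusp^±(†𝒟_v)` — which is well-defined up to
multiplication by `±1`, and which may be constructed solely from `†𝒟_v` [cf. Definition 4.1, (ii)] — such
that, relative to the natural bijection `{LabCusp^±(†𝒟_v) ∖ {†η⁰_v}}/{±1} ⥲ LabCusp(†𝒟_v)` [cf. the notation of
Definition 4.1, (ii)], we have `†η^±_v ↦ †η_v`.  In particular, we obtain a natural bijection
`LabCusp^±(†𝒟_v) ⥲ 𝔽_l` — which is well-defined up to multiplication by `±1` and compatible, relative to the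
natural bijection to “`LabCusp(−)`” of the preceding display, with the natural bijection of the second
display of Proposition 4.2" ([IUTchI] Def 6.1 (iii) p.156) [claim: Mochizuki2012, status: disputed]
(D-0012 claim key, series status DISPUTED — this file is label bookkeeping between two landed typings of the
cell; nothing of the series is asserted, no side is taken on [IUTchIII] Cor. 3.12).

This is the second printed §4 ↔ §6 link of merge canon C9-h (after Def 6.1 (i), `KitCoreBridge.lean`): the
`±`-label classes of cusps `LabCusp^±(†𝒟_v)` of abc-iut-L5-t4's §6 kit (`PMBaseKit.LabCuspPM` with its
`𝔽_l^±`-group structure `labPM` = the orbit of charts `LabCusp^± ⥲ 𝔽_l`, Def 6.1 (i)/(iii)) versus the label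
classes of cusps `LabCusp(†𝒟_v)` of abc-iut-L5-t3's §4 datum (`BaseThetaDatum.LabCusp`, an `𝔽_l^⋇`-torsor with
canonical element `η`, Def 4.1 (ii) / Prop 4.2).  In the two typings BOTH sides carry a canonical labelling by
`𝔽_l^⋇` — the kit's `(LabCusp^± ∖ {η⁰})/{±1} ⥲ 𝔽_l^×/{±1}` read in any chart (`FlPMGroup.absStarLabel`, defined
here for an arbitrary `𝔽_l^±`-group; cf. abc-iut-L5-t4's `starLabel`/`absLabel` for the index group of a
Θ^±-bridge, identified by `ofFin_starLabel`), and the datum's `LabCusp ⥲ 𝔽_l^⋇` of Prop 4.2 (`IsTorsor.labelEquiv`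
at `η`) — so that the printed bijection EXISTS, is UNIQUE under the printed compatibility, sends the
`±`-canonical class to `η`, and is natural, all as THEOREMS (`KitCore.labAbs`, `labelEquiv_labAbs`,
`labAbs_unique`, `labAbs_etaPM`, `labAbs_natural`): no new hypothesis field is needed on `KitCore`.

Contents: `FlPMGroup.starLabelOf` / `absStarLabel` / `absStarEquiv` (the label `∈ 𝔽_l^⋇` of a nonzero `±`-class,
chart-independent, a bijection `(E ∖ {0})/{±1} ⥲ 𝔽_l^⋇`), `FlPMGroup.etaPM` / `etaPMAbs` (the `±`-canonical
element: chart value `±1`), `FlPMGroup.absStarMap` (functoriality of `±`-classes along chart-compatible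
bijections), `DThetaPMBridge.ofFin_starLabel` (abc-iut-L5-t4's labelling `T^⋇ ⥲ {1, …, l^⋇}` IS `absStarLabel`
through the dictionary `FlStar.ofFin`), and the `KitCore` theorems above.  Definitions + proofs; every
`theorem` kernel-checked; typed ≠ proved elsewhere.
-/

namespace Literature.IUT.HodgeTheaters

open CategoryTheory

universe u

/-! ### Labels `∈ 𝔽_l^⋇` of nonzero `±`-classes of an `𝔽_l^±`-group -/

section FlStarQuotient

variable (l : ℕ) [Fact l.Prime]

/-- Two units of `𝔽_l` have the same image in `𝔽_l^⋇ = 𝔽_l^×/{±1}` iff they agree up to sign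
(§4 p. 95 "`𝔽_l^⋇ := 𝔽_l^×/{±1}`"). ([IUTchI] Ex 4.4 (i) p.105) [claim: Mochizuki2012, status: disputed] -/
theorem flStar_mk_eq_iff (u w : (ZMod l)ˣ) :
    FlStar.mk l w = FlStar.mk l u ↔ (w : ZMod l) = u ∨ (w : ZMod l) = -u := by
  constructor
  · intro h
    have h' : w⁻¹ * u ∈ unitsPlusMinus l := QuotientGroup.eq.mp h
    rcases (mem_unitsPlusMinus_iff _).1 h' with h1 | h1
    · left
      rw [inv_mul_eq_one] at h1
      rw [h1]
    · right
      rw [inv_mul_eq_iff_eq_mul] at h1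
      have h2 := congrArg (fun x : (ZMod l)ˣ => (x : ZMod l)) h1
      simp only [Units.val_neg, mul_neg, mul_one] at h2
      rw [h2, neg_neg]
  · intro h
    apply QuotientGroup.eq.mpr
    rw [mem_unitsPlusMinus_iff]
    rcases h with h | h
    · left
      rw [inv_mul_eq_one]
      exact Units.ext h
    · right
      apply Units.ext
      have hu : (u : ZMod l) ≠ 0 := u.ne_zero
      rw [Units.val_mul, Units.val_inv_eq_inv_val, h, Units.val_neg, Units.val_one, inv_neg, neg_mul,
        inv_mul_cancel₀ hu]

end FlStarQuotient

namespace FlPMGroup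

variable {l : ℕ} {E : Type*} (S : FlPMGroup l E)

/-- A `±`-class `|t|` is the class of zero iff the (any) chart value of `t` vanishes.
([IUTchI] Def 6.1 (iii) p.156) [claim: Mochizuki2012, status: disputed] -/
theorem toAbs_eq_toAbs_zero_iff (t : E) : S.toAbs t = S.toAbs S.zero ↔ S.chart₀ t = 0 := by
  rw [S.toAbs_eq_toAbs_iff]
  constructor
  · rintro (h | h)
    · rw [← h]; exact S.chart_zero S.chart₀_mem
    · have h' := congrArg S.neg h
      rw [S.neg_zero, S.neg_neg] at h'
      rw [← h']; exact S.chart_zero S.chart₀_mem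
  · intro h
    left
    apply S.chart₀.injective
    rw [S.chart_zero S.chart₀_mem, h]

/-- All charts vanish together (they differ by a sign). ([IUTchI] Def 6.1 (i) p.155) [claim: Mochizuki2012, status: disputed] -/
theorem chart_eq_zero_iff {e : E ≃ ZMod l} (he : e ∈ S.charts) (t : E) : e t = 0 ↔ S.chart₀ t = 0 := by
  obtain ⟨ε, rfl⟩ := S.exists_sign_of_mem S.chart₀_mem he
  simp only [Equiv.trans_apply, signPerm_apply]
  exact smul_eq_zero_iff_eq ε

variable [Fact l.Prime]

/-- The label `∈ 𝔽_l^⋇ = 𝔽_l^×/{±1}` of an element of an `𝔽_l^±`-group whose `±`-class is nonzero: the class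
of its (nonzero) chart value — "a natural bijection `LabCusp^±(†𝒟_v) ⥲ 𝔽_l` … well-defined up to
multiplication by `±1`" read modulo `±1`. ([IUTchI] Def 6.1 (iii) p.156) [claim: Mochizuki2012, status: disputed] -/
noncomputable def starLabelOf (t : E) (ht : S.toAbs t ≠ S.toAbs S.zero) : FlStar l :=
  FlStar.mk l (Units.mk0 (S.chart₀ t) ((not_congr (S.toAbs_eq_toAbs_zero_iff t)).1 ht))

/-- `starLabelOf` does not depend on the proof of nonzeroness. ([IUTchI] Def 6.1 (iii) p.156) [claim: Mochizuki2012, status: disputed] -/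
theorem starLabelOf_congr {t t' : E} (h : t = t') (ht : S.toAbs t ≠ S.toAbs S.zero)
    (ht' : S.toAbs t' ≠ S.toAbs S.zero) : S.starLabelOf t ht = S.starLabelOf t' ht' := by
  subst h; rfl

/-- The label may be read in ANY chart of the orbit ("well-defined up to multiplication by `±1`").
([IUTchI] Def 6.1 (iii) p.156) [claim: Mochizuki2012, status: disputed] -/
theorem starLabelOf_eq_of_mem {e : E ≃ ZMod l} (he : e ∈ S.charts) (t : E) (ht : S.toAbs t ≠ S.toAbs S.zero)
    (hne : e t ≠ 0) : S.starLabelOf t ht = FlStar.mk l (Units.mk0 (e t) hne) := by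
  obtain ⟨ε, rfl⟩ := S.exists_sign_of_mem S.chart₀_mem he
  unfold starLabelOf
  apply (flStar_mk_eq_iff l _ _).2
  simp only [Units.val_mk0, Equiv.trans_apply, signPerm_apply]
  rcases Int.units_eq_one_or ε with rfl | rfl
  · left; simp
  · right; simp

/-- `−t` has the same label as `t`. ([IUTchI] Def 6.1 (iii) p.156) [claim: Mochizuki2012, status: disputed] -/
theorem starLabelOf_neg (t : E) (ht : S.toAbs t ≠ S.toAbs S.zero)
    (ht' : S.toAbs (S.neg t) ≠ S.toAbs S.zero) : S.starLabelOf (S.neg t) ht' = S.starLabelOf t ht := by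
  unfold starLabelOf
  apply (flStar_mk_eq_iff l _ _).2
  right
  rw [Units.val_mk0, Units.val_mk0, S.chart_neg S.chart₀_mem]

/-- The label read in `ℕ` (abc-iut-L5-t3's `FlStar.absVal`, Prop 4.11 (i)) is the least absolute residue of
the chart value. ([IUTchI] Prop 4.11 (i) p.120) [claim: Mochizuki2012, status: disputed] -/
theorem absVal_starLabelOf (t : E) (ht : S.toAbs t ≠ S.toAbs S.zero) :
    FlStar.absVal l (S.starLabelOf t ht) = (S.chart₀ t).valMinAbs.natAbs := rfl

/-- **The label `∈ 𝔽_l^⋇` of a nonzero `±`-class** of an `𝔽_l^±`-group: for `LabCusp^±(†𝒟_v)` this is the map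
`{LabCusp^±(†𝒟_v) ∖ {†η⁰_v}}/{±1} → 𝔽_l^⋇` induced by "the natural bijection `LabCusp^±(†𝒟_v) ⥲ 𝔽_l` … well-defined
up to multiplication by `±1`". ([IUTchI] Def 6.1 (iii) p.156) [claim: Mochizuki2012, status: disputed] -/
noncomputable def absStarLabel (q : S.AbsStar) : FlStar l :=
  S.starLabelOf (Quotient.out q.1)
    (by have hq : S.toAbs (Quotient.out q.1) = q.1 := Quotient.out_eq q.1; rw [hq]; exact q.2)

/-- The label of `|t|` is the label of `t`. ([IUTchI] Def 6.1 (iii) p.156) [claim: Mochizuki2012, status: disputed] -/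
theorem absStarLabel_mk (t : E) (ht : S.toAbs t ≠ S.toAbs S.zero) :
    S.absStarLabel ⟨S.toAbs t, ht⟩ = S.starLabelOf t ht := by
  unfold absStarLabel
  rcases S.out_toAbs t with h | h
  · exact S.starLabelOf_congr h _ _
  · exact (S.starLabelOf_congr h _ (by rw [S.toAbs_neg]; exact ht)).trans (S.starLabelOf_neg t ht _)

/-- Distinct nonzero `±`-classes have distinct labels. ([IUTchI] Def 6.1 (iii) p.156) [claim: Mochizuki2012, status: disputed] -/
theorem absStarLabel_injective : Function.Injective S.absStarLabel := by
  rintro ⟨q, hq⟩ ⟨q', hq'⟩ h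
  obtain ⟨t, rfl⟩ := S.toAbs_surjective q
  obtain ⟨t', rfl⟩ := S.toAbs_surjective q'
  rw [S.absStarLabel_mk t hq, S.absStarLabel_mk t' hq'] at h
  unfold starLabelOf at h
  have h' := (flStar_mk_eq_iff l _ _).1 h
  simp only [Units.val_mk0] at h'
  apply Subtype.ext
  show S.toAbs t = S.toAbs t'
  rw [S.toAbs_eq_toAbs_iff]
  rcases h' with h' | h'
  · left; exact (S.chart₀.injective h').symm
  · right
    apply S.chart₀.injective
    rw [S.chart_neg S.chart₀_mem, h', _root_.neg_neg]

/-- Every label occurs. ([IUTchI] Def 6.1 (iii) p.156) [claim: Mochizuki2012, status: disputed] -/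
theorem absStarLabel_surjective : Function.Surjective S.absStarLabel := by
  intro x
  induction x using QuotientGroup.induction_on with
  | H u =>
    have hu : (u : ZMod l) ≠ 0 := u.ne_zero
    have hct : S.chart₀ (S.chart₀.symm (u : ZMod l)) = u := S.chart₀.apply_symm_apply _
    have ht : S.toAbs (S.chart₀.symm (u : ZMod l)) ≠ S.toAbs S.zero :=
      (not_congr (S.toAbs_eq_toAbs_zero_iff _)).2 (by rw [hct]; exact hu)
    refine ⟨⟨S.toAbs (S.chart₀.symm (u : ZMod l)), ht⟩, ?_⟩
    rw [S.absStarLabel_mk _ ht]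
    exact congrArg (FlStar.mk l) (Units.ext hct)

/-- **`{E ∖ {0}}/{±1} ⥲ 𝔽_l^⋇`**: the labels form a bijection (for `LabCusp^±(†𝒟_v)`: the natural bijection
`LabCusp^± ⥲ 𝔽_l` of Def 6.1 (iii), taken modulo `±1` away from zero). ([IUTchI] Def 6.1 (iii) p.156) [claim: Mochizuki2012, status: disputed] -/
noncomputable def absStarEquiv : S.AbsStar ≃ FlStar l :=
  Equiv.ofBijective S.absStarLabel ⟨S.absStarLabel_injective, S.absStarLabel_surjective⟩

/-- `absStarEquiv` is `absStarLabel`. ([IUTchI] Def 6.1 (iii) p.156) [claim: Mochizuki2012, status: disputed] -/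
@[simp] theorem absStarEquiv_apply (q : S.AbsStar) : S.absStarEquiv q = S.absStarLabel q := rfl

/-! ### The `±`-canonical element -/

/-- **The `±`-canonical element `†η^±_v`** of an `𝔽_l^±`-group — "well-defined up to multiplication by `±1`"
([IUTchI] Def 6.1 (iii) p. 156): in abc-iut-L5-t4's typing the `𝔽_l^±`-group structure (the orbit of charts
`⥲ 𝔽_l`) is primary and the `±`-canonical element is recovered as the element of chart value `1` (for the
other chart of the orbit, `−1`). ([IUTchI] Def 6.1 (iii) p.156) [claim: Mochizuki2012, status: disputed] -/
noncomputable def etaPM : E := S.chart₀.symm 1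

/-- The chart value of the `±`-canonical element is `1`. ([IUTchI] Def 6.1 (iii) p.156) [claim: Mochizuki2012, status: disputed] -/
theorem chart₀_etaPM : S.chart₀ S.etaPM = 1 := S.chart₀.apply_symm_apply 1

/-- **The `±`-canonical class `|†η^±_v| ∈ {LabCusp^± ∖ {η⁰}}/{±1}`** (nonzero since `1 ≠ 0` in `𝔽_l`).
([IUTchI] Def 6.1 (iii) p.156) [claim: Mochizuki2012, status: disputed] -/
noncomputable def etaPMAbs : S.AbsStar :=
  ⟨S.toAbs S.etaPM, (not_congr (S.toAbs_eq_toAbs_zero_iff _)).2 (by rw [S.chart₀_etaPM]; exact one_ne_zero)⟩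

/-- The `±`-canonical class has label `1 ∈ 𝔽_l^⋇`. ([IUTchI] Def 6.1 (iii) p.156) [claim: Mochizuki2012, status: disputed] -/
theorem absStarLabel_etaPMAbs : S.absStarLabel S.etaPMAbs = 1 := by
  unfold etaPMAbs
  rw [S.absStarLabel_mk]
  have h : Units.mk0 (S.chart₀ S.etaPM) ((not_congr (S.toAbs_eq_toAbs_zero_iff S.etaPM)).1
      ((not_congr (S.toAbs_eq_toAbs_zero_iff _)).2 (by rw [S.chart₀_etaPM]; exact one_ne_zero))) = 1 :=
    Units.ext (by rw [Units.val_mk0, S.chart₀_etaPM, Units.val_one])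
  unfold starLabelOf
  rw [h]
  rfl

/-! ### Functoriality of `±`-classes along chart-compatible bijections -/

variable {E' : Type*} (S' : FlPMGroup l E')

omit [Fact l.Prime] in
/-- A bijection pulling charts back to charts commutes with `−1`. ([IUTchI] Def 6.1 (i) p.155) [claim: Mochizuki2012, status: disputed] -/
theorem map_neg_of_charts (f : E ≃ E') (hf : ∀ e' ∈ S'.charts, f.trans e' ∈ S.charts) (t : E) :
    f (S.neg t) = S'.neg (f t) := by
  apply S'.chart₀.injective
  rw [S'.chart_neg S'.chart₀_mem]
  exact S.chart_neg (hf _ S'.chart₀_mem) t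

omit [Fact l.Prime] in
/-- A bijection pulling charts back to charts preserves zero. ([IUTchI] Def 6.1 (i) p.155) [claim: Mochizuki2012, status: disputed] -/
theorem map_zero_of_charts (f : E ≃ E') (hf : ∀ e' ∈ S'.charts, f.trans e' ∈ S.charts) :
    f S.zero = S'.zero := by
  apply S'.chart₀.injective
  rw [S'.chart_zero S'.chart₀_mem]
  exact S.chart_zero (hf _ S'.chart₀_mem)

omit [Fact l.Prime] in
/-- The map on `±`-classes induced by a chart-compatible bijection (e.g. by `LabCusp^±(φ)` for an isomorphism
`φ : †𝒟_v ⥲ ‡𝒟_v`, abc-iut-L5-t4's `labMap_charts`). ([IUTchI] Def 6.1 (iii) p.156) [claim: Mochizuki2012, status: disputed] -/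
def absMap (f : E ≃ E') (hf : ∀ e' ∈ S'.charts, f.trans e' ∈ S.charts) : S.Abs → S'.Abs :=
  Quotient.map f fun a b h => by
    rcases h with h | h
    · exact Or.inl (congrArg f h)
    · rw [h]; exact Or.inr (S.map_neg_of_charts S' f hf a)

omit [Fact l.Prime] in
/-- `absMap` on a class. ([IUTchI] Def 6.1 (iii) p.156) [claim: Mochizuki2012, status: disputed] -/
theorem absMap_toAbs (f : E ≃ E') (hf : ∀ e' ∈ S'.charts, f.trans e' ∈ S.charts) (t : E) :
    S.absMap S' f hf (S.toAbs t) = S'.toAbs (f t) := rfl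

omit [Fact l.Prime] in
/-- `absMap` preserves nonzero classes. ([IUTchI] Def 6.1 (iii) p.156) [claim: Mochizuki2012, status: disputed] -/
theorem absMap_ne_zero (f : E ≃ E') (hf : ∀ e' ∈ S'.charts, f.trans e' ∈ S.charts) (q : S.AbsStar) :
    S.absMap S' f hf q.1 ≠ S'.toAbs S'.zero := by
  obtain ⟨t, ht⟩ := S.toAbs_surjective q.1
  rw [← ht, S.absMap_toAbs S' f hf t]
  intro h
  apply q.2
  rw [← ht, S.toAbs_eq_toAbs_zero_iff, ← S.chart_eq_zero_iff (hf _ S'.chart₀_mem)]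
  exact (S'.toAbs_eq_toAbs_zero_iff (f t)).1 h

omit [Fact l.Prime] in
/-- The map on NONZERO `±`-classes induced by a chart-compatible bijection.
([IUTchI] Def 6.1 (iii) p.156) [claim: Mochizuki2012, status: disputed] -/
def absStarMap (f : E ≃ E') (hf : ∀ e' ∈ S'.charts, f.trans e' ∈ S.charts) : S.AbsStar → S'.AbsStar :=
  fun q => ⟨S.absMap S' f hf q.1, S.absMap_ne_zero S' f hf q⟩

/-- A chart-compatible bijection preserves labels `∈ 𝔽_l^⋇` ("natural bijection").
([IUTchI] Def 6.1 (iii) p.156) [claim: Mochizuki2012, status: disputed] -/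
theorem absStarLabel_absStarMap (f : E ≃ E') (hf : ∀ e' ∈ S'.charts, f.trans e' ∈ S.charts)
    (q : S.AbsStar) : S'.absStarLabel (S.absStarMap S' f hf q) = S.absStarLabel q := by
  obtain ⟨q, hq⟩ := q
  obtain ⟨t, rfl⟩ := S.toAbs_surjective q
  have hne : (f.trans S'.chart₀) t ≠ 0 := fun h =>
    hq ((S.toAbs_eq_toAbs_zero_iff t).2 ((S.chart_eq_zero_iff (hf _ S'.chart₀_mem) t).1 h))
  have hft : S'.toAbs (f t) ≠ S'.toAbs S'.zero :=
    (not_congr (S'.toAbs_eq_toAbs_zero_iff (f t))).2 hne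
  change S'.absStarLabel ⟨S'.toAbs (f t), hft⟩ = S.absStarLabel ⟨S.toAbs t, hq⟩
  rw [S'.absStarLabel_mk (f t) hft, S.absStarLabel_mk t hq,
    S.starLabelOf_eq_of_mem (hf _ S'.chart₀_mem) t hq hne]
  rfl

end FlPMGroup

/-! ### abc-iut-L5-t4's labelling of `T^⋇` IS the label `∈ 𝔽_l^⋇` -/

namespace PMBaseKit.DThetaPMBridge

variable {l : ℕ} [Fact l.Prime] {K : PMBaseKit.{u} l} (B : K.DThetaPMBridge)

/-- abc-iut-L5-t4's `absLabel` (least positive representative, Def 6.4 (i) / Prop 6.9 (i)) is the `ℕ`-reading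
(abc-iut-L5-t3's `FlStar.absVal`) of the label `∈ 𝔽_l^⋇`. ([IUTchI] Def 6.4 (i) p.162) [claim: Mochizuki2012, status: disputed] -/
theorem absVal_absStarLabel (q : B.grpT.AbsStar) :
    FlStar.absVal l (B.grpT.absStarLabel q) = B.absLabel q.1 := by
  haveI : NeZero l := ⟨(Fact.out : l.Prime).ne_zero⟩
  have hq : B.grpT.toAbs (Quotient.out q.1) = q.1 := Quotient.out_eq q.1
  have hz : B.grpT.chart₀ (Quotient.out q.1) ≠ 0 :=
    (not_congr (B.grpT.toAbs_eq_toAbs_zero_iff _)).1 (by rw [hq]; exact q.2)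
  unfold FlPMGroup.absStarLabel
  rw [FlPMGroup.absVal_starLabelOf, B.absLabel_eq, ZMod.valMinAbs_natAbs_eq_min, ZMod.neg_val, if_neg hz]

/-- **The dictionary is consistent with both typings' labellings**: abc-iut-L5-t4's canonical labelling
`starLabel : T^⋇ ⥲ {1, …, l^⋇}` of Def 6.4 (i), read in `𝔽_l^⋇` through `FlStar.ofFin`, IS the label `∈ 𝔽_l^⋇` of
the `±`-class ("`T^⋇` … may be naturally identified with `𝔽_l^⋇`"). ([IUTchI] Def 6.4 (i) p.162) [claim: Mochizuki2012, status: disputed] -/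
theorem ofFin_starLabel (hl : Odd l) (q : B.grpT.AbsStar) :
    FlStar.ofFin l (B.starLabel hl q) = B.grpT.absStarLabel q :=
  FlStar.absVal_injective l (by rw [B.absVal_ofFin_starLabel hl q, B.absVal_absStarLabel q])

end PMBaseKit.DThetaPMBridge

/-! ### Definition 6.1 (iii) through the dictionary -/

namespace BaseThetaDatum.KitCore

variable {𝔡 : BaseThetaDatum.{u}} {K : PMBaseKit.{u} 𝔡.l} (c : 𝔡.KitCore K)

/-- The `𝔽_l^±`-group structure on `LabCusp^±(†𝒟_v)` (abc-iut-L5-t4's `labPM`, Def 6.1 (iii)) of the kit object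
underlying an isomorph `Y = †𝒟_v` of the datum. ([IUTchI] Def 6.1 (iii) p.156) [claim: Mochizuki2012, status: disputed] -/
noncomputable def labPMOf (x : K.V) (Y : 𝔡.Amb (c.e x)) : FlPMGroup 𝔡.l (K.LabCuspPM x ((c.amb x).obj Y)) :=
  K.labPM x ((c.amb x).obj Y) (c.isLocal_obj x Y)

/-- **[IUTchI] Def 6.1 (iii): the natural bijection `{LabCusp^±(†𝒟_v) ∖ {†η⁰_v}}/{±1} ⥲ LabCusp(†𝒟_v)`** between
the nonzero `±`-label classes of cusps of the kit object (abc-iut-L5-t4) and the label classes of cusps of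
Def 4.1 (ii) (abc-iut-L5-t3): the composite of the two canonical labellings by `𝔽_l^⋇` — `absStarEquiv`
(Def 6.1 (iii) "`LabCusp^± ⥲ 𝔽_l` … up to `±1`") and the inverse of Prop 4.2's `LabCusp(†𝒟_v) ⥲ 𝔽_l^⋇`
(`IsTorsor.labelEquiv` at `†η_v`).  By `labAbs_unique` it is THE bijection with the printed compatibility.
([IUTchI] Def 6.1 (iii) p.156) [claim: Mochizuki2012, status: disputed] -/
noncomputable def labAbs (x : K.V) (Y : 𝔡.Amb (c.e x)) : (c.labPMOf x Y).AbsStar ≃ 𝔡.LabCusp (c.e x) Y :=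
  (c.labPMOf x Y).absStarEquiv.trans ((𝔡.isTorsor_labCusp (c.e x) Y).labelEquiv (𝔡.η (c.e x) Y)).symm

/-- **Compatibility with Proposition 4.2** ("compatible, relative to the natural bijection to `LabCusp(−)` …,
with the natural bijection of the second display of Proposition 4.2"): reading `labAbs q` through Prop 4.2's
`LabCusp(†𝒟_v) ⥲ 𝔽_l^⋇` (the labelling by `†η_v` and the torsor structure; component at `v` of abc-iut-L5-t3's
`DPrimeStrip.labEquiv`) gives the kit-side label of `q`. ([IUTchI] Def 6.1 (iii) p.157) [claim: Mochizuki2012, status: disputed] -/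
theorem labelEquiv_labAbs (x : K.V) (Y : 𝔡.Amb (c.e x)) (q : (c.labPMOf x Y).AbsStar) :
    (𝔡.isTorsor_labCusp (c.e x) Y).labelEquiv (𝔡.η (c.e x) Y) (c.labAbs x Y q) =
      (c.labPMOf x Y).absStarLabel q := by
  simp [labAbs]

/-- `labAbs q` is the translate of `†η_v` by the kit-side label of `q`. ([IUTchI] Def 6.1 (iii) p.156) [claim: Mochizuki2012, status: disputed] -/
theorem labAbs_eq (x : K.V) (Y : 𝔡.Amb (c.e x)) (q : (c.labPMOf x Y).AbsStar) :
    c.labAbs x Y q = (c.labPMOf x Y).absStarLabel q • 𝔡.η (c.e x) Y := by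
  apply ((𝔡.isTorsor_labCusp (c.e x) Y).labelEquiv (𝔡.η (c.e x) Y)).injective
  rw [labelEquiv_labAbs, IsTorsor.labelEquiv_smul_self]

/-- **"`†η^±_v ↦ †η_v`"**: the `±`-canonical class goes to the canonical element of Def 4.1 (ii).
([IUTchI] Def 6.1 (iii) p.156) [claim: Mochizuki2012, status: disputed] -/
theorem labAbs_etaPM (x : K.V) (Y : 𝔡.Amb (c.e x)) :
    c.labAbs x Y (c.labPMOf x Y).etaPMAbs = 𝔡.η (c.e x) Y := by
  rw [labAbs_eq, FlPMGroup.absStarLabel_etaPMAbs, one_smul]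

/-- **Uniqueness**: a bijection `{LabCusp^± ∖ {η⁰}}/{±1} ⥲ LabCusp(†𝒟_v)` compatible with the two labellings by
`𝔽_l^⋇` (Def 6.1 (iii) / Prop 4.2) IS `labAbs` — the printed compatibility pins the bijection down.
([IUTchI] Def 6.1 (iii) p.157) [claim: Mochizuki2012, status: disputed] -/
theorem labAbs_unique (x : K.V) (Y : 𝔡.Amb (c.e x)) (f : (c.labPMOf x Y).AbsStar ≃ 𝔡.LabCusp (c.e x) Y)
    (hf : ∀ q, (𝔡.isTorsor_labCusp (c.e x) Y).labelEquiv (𝔡.η (c.e x) Y) (f q) =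
      (c.labPMOf x Y).absStarLabel q) :
    f = c.labAbs x Y := by
  ext q
  apply ((𝔡.isTorsor_labCusp (c.e x) Y).labelEquiv (𝔡.η (c.e x) Y)).injective
  rw [hf, labelEquiv_labAbs]

/-- `LabCusp^±(φ)` for an isomorphism `φ : †𝒟_v ⥲ ‡𝒟_v` of the datum pulls charts back to charts (abc-iut-L5-t4's
`labMap_charts`), so it induces a map on nonzero `±`-classes. ([IUTchI] Def 6.1 (iii) p.156) [claim: Mochizuki2012, status: disputed] -/
theorem labMap_charts_of (x : K.V) {Y Y' : 𝔡.Amb (c.e x)} (φ : Y ≅ Y') :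
    ∀ e' ∈ (c.labPMOf x Y').charts, (K.labMap x ((c.amb x).mapIso φ)).trans e' ∈ (c.labPMOf x Y).charts :=
  K.labMap_charts x _ _ ((c.amb x).mapIso φ)

/-- **Naturality** ("natural bijection"): for an isomorphism `φ : †𝒟_v ⥲ ‡𝒟_v`, transporting a nonzero `±`-class by
`LabCusp^±(φ)` (abc-iut-L5-t4's `labMap`) and then applying `labAbs` equals applying `labAbs` and then
`LabCusp(φ)` (abc-iut-L5-t3's `labIso`). ([IUTchI] Def 6.1 (iii) p.156) [claim: Mochizuki2012, status: disputed] -/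
theorem labAbs_natural (x : K.V) {Y Y' : 𝔡.Amb (c.e x)} (φ : Y ≅ Y') (q : (c.labPMOf x Y).AbsStar) :
    c.labAbs x Y' ((c.labPMOf x Y).absStarMap (c.labPMOf x Y') (K.labMap x ((c.amb x).mapIso φ))
        (c.labMap_charts_of x φ) q) =
      𝔡.labIso φ (c.labAbs x Y q) := by
  rw [labAbs_eq, labAbs_eq, FlPMGroup.absStarLabel_absStarMap, 𝔡.labIso_smul, 𝔡.labIso_η]

end BaseThetaDatum.KitCore

end Literature.IUT.HodgeTheaters
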